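import Literature.Geometry.Symplectic.AlmostComplexTangentSection
import Literature.Geometry.Symplectic.CanonicalClass
import Literature.AlgebraicTopology.CharacteristicClasses.TopChernNumberLocalization
import HarnessLib

/-!
# The top Chern number of an almost complex manifold localises at the zeros of a vector field

D. McDuff, D. Salamon, *Introduction to Symplectic Topology*, 3rd ed. (2017), Ex. 4.4.3 (v)
("the integral of `c₂(TX) ∈ H⁴(X; ℤ)` is the Euler characteristic", for an almost complex
`4`-manifold, computed from a vector field) with Rem. 2.7.2 and Thm. 2.7.5 (zeros counted with
multiplicity); F. Hirzebruch, *Topological Methods in Algebraic Geometry* (3rd ed. 1966),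
Thm. 4.10.1 (`c_n[X] = Euler number`); J. Milnor, J. Stasheff, *Characteristic Classes* (1974),
§12 and §14 (`cₙ(ω) = e(ω_ℝ)`, the Euler number as the sum of the indices of a vector field,
Cor. 11.12); R. Bott, L. Tu (1982), Thm. 11.17.

For an almost complex manifold `(M, J)` modelled on `E` (`dim_ℝ E = 2k`) the localisation theorem
of `TopChernNumberLocalization` for the complex tangent bundle `(TM, J)` (rank `k`,
`complexTangentBundle`) and the section `x ↦ β_x(Y x)` attached to a continuous vector field `Y`
(`fieldSection`, `AlmostComplexTangentSection`) reads

  `⟨c_k(TM, J), [M]_μ⟩ = Σ_{p : Y p = 0} ind_p(Y)`   (`kroneckerPairing_chernClass_eq_sum_localIndex`)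

for `M` closed (compact Hausdorff, charts `ℝ²ᵏ`), any `ℤ`-orientation `μ` in degree `2k` and any
continuous vector field `Y` with finitely many zeros, the index `ind_p(Y) ∈ ℤ` being the local
index of `TopChernNumberLocalization` (`vectorFieldIndex`); in dimension four
(`kroneckerPairing_chernClass_two_eq_sum_vectorFieldIndex`) this is the shape
`⟨c₂(TN, J), [N]⟩ = Σ ind_p` of hypothesis `hc₂` of
`hirzebruch_firstChernClass_sq_eq_almostComplex_four_of_signatureTheorem_of_topChernNumber`, which
thereby reduces to the Poincaré–Hopf count `Σ_p ind_p(Y) = χ(N)` for ONE vector field.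
Everything is proved; no named facts.

## References

* D. McDuff, D. Salamon, *Introduction to Symplectic Topology*, 3rd ed., OUP 2017, Rem. 2.7.2,
  Thm. 2.7.5, Ex. 4.4.3 (v). [McDuffSalamon2017]
* F. Hirzebruch, *Topological Methods in Algebraic Geometry*, 3rd ed., Springer 1966,
  Thm. 4.10.1 (p. 71). [Hirzebruch1966]
* J. Milnor, J. Stasheff, *Characteristic Classes*, Ann. of Math. Stud. 76, PUP 1974, Cor. 11.12,
  §12, §14. [MilnorStasheff1974]
* R. Bott, L. W. Tu, *Differential Forms in Algebraic Topology*, GTM 82, Springer 1982,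
  Thm. 11.17. [BottTu1982]
-/

noncomputable section

open scoped Manifold ContDiff
open Bundle Set Module Literature.AlgebraicTopology.SingularHomology
  Literature.AlgebraicTopology.CharacteristicClasses

namespace Literature.AlgebraicTopology.CharacteristicClasses.ComplexVectorBundle

/-- Degree bookkeeping: `c_i(E)` and `c_j(E)` cast to degree `n` agree when `i = j`. [folklore] -/
theorem degCast_chernClassZ_congr {B : Type} [TopologicalSpace B] (E : ComplexVectorBundle.{0, 0} B)
    {i j n : ℕ} (hij : i = j) (hi : 2 * i = n) (hj : 2 * j = n) :
    degCast ℤ hi (chernClassZ E i) = degCast ℤ hj (chernClassZ E j) := by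
  subst hij
  rfl

end Literature.AlgebraicTopology.CharacteristicClasses.ComplexVectorBundle

namespace Literature.Geometry.Symplectic

namespace AlmostComplexStructure

variable {E : Type*} [NormedAddCommGroup E] [NormedSpace ℝ E] [FiniteDimensional ℝ E]
  {H : Type*} [TopologicalSpace H] {I : ModelWithCorners ℝ E H}
  {M : Type} [TopologicalSpace M] [ChartedSpace H M] [IsManifold I 1 M] {m : WithTop ℕ∞}
  (J : AlmostComplexStructure I m M)

/-- The zeros of the section `x ↦ β_x(Y x)` of `(TM, J)` are the zeros of the vector field `Y`.
[folklore] -/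
theorem zeroSet_fieldSection (Y : Π x : M, TangentSpace I x) : zeroSet (J.fieldSection Y) = {x | Y x = 0} :=
  Set.ext fun x ↦ (mem_zeroSet_iff (s := J.fieldSection Y) (b := x)).trans (J.fieldSection_eq_zero_iff Y x)

/-- A vector field with finitely many zeros gives a section of `(TM, J)` with finitely many zeros.
[folklore] -/
theorem finite_zeroSet_fieldSection {Y : Π x : M, TangentSpace I x} (hZ : {x | Y x = 0}.Finite) :
    (zeroSet (J.fieldSection Y)).Finite := by
  rwa [J.zeroSet_fieldSection Y]

/-- Degree bookkeeping: `cᵢ(TM, J)` and `cⱼ(TM, J)` cast to degree `n` agree when `i = j`. [folklore] -/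
theorem degCast_chernClass_congr {i j n : ℕ} (hij : i = j) (hi : 2 * i = n) (hj : 2 * j = n) :
    degCast ℤ hi (J.chernClass i) = degCast ℤ hj (J.chernClass j) := by
  subst hij
  rfl

/-- `rank (TM, J) > 0` when `dim M ≥ 2`. [folklore] -/
theorem rank_complexTangentBundle_pos (hk : 0 < finrank ℝ E / 2) : 0 < J.complexTangentBundle.rank := by
  rw [J.rank_complexTangentBundle]; exact hk

/-- `2 · rank (TM, J) = n` when `2 (dim M / 2) = n`. [folklore] -/
theorem two_mul_rank_complexTangentBundle {n : ℕ} (hn : 2 * (finrank ℝ E / 2) = n) :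
    2 * J.complexTangentBundle.rank = n := by
  rw [J.rank_complexTangentBundle]; exact hn

variable [T2Space M] [CompactSpace M]

/-- **The index `ind_p(Y) ∈ ℤ` of a continuous vector field at a point**, with respect to a
`ℤ`-orientation `μ` of `M` in degree `n = 2 (dim M / 2)`: the local index
(`ComplexVectorBundle.localIndex`, the relative Kronecker pairing of the pulled-back relative Thom
class of `(TM, J)` with the local orientation `μ_p`) of the section `x ↦ β_x(Y x)` of `(TM, J)`
(McDuff–Salamon Thm. 2.7.5 / Ex. 4.4.3 (v): zeros counted with multiplicity).
[cite: McDuffSalamon2017, Thm. 2.7.5 and Ex. 4.4.3 (v)] -/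
def vectorFieldIndex {Y : Π x : M, TangentSpace I x} (hY : Continuous fun x ↦ (⟨x, Y x⟩ : TangentBundle I M))
    (hk : 0 < finrank ℝ E / 2) {n : ℕ} (hn : 2 * (finrank ℝ E / 2) = n) (μ : HomologicalOrientation ℤ M n)
    (p : M) : ℤ :=
  J.complexTangentBundle.localIndex (J.fieldSection Y) (J.continuous_fieldSection hY) ℤ
    (J.rank_complexTangentBundle_pos hk) (J.two_mul_rank_complexTangentBundle hn) μ p

/-- **Localisation of the top Chern number of an almost complex manifold at the zeros of a vector
field**: `⟨c_k(TM, J), [M]_μ⟩ = Σ_{Y p = 0} ind_p(Y)` (`dim M = 2k ≥ 2`, `M` closed, `Y` continuous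
with finitely many zeros, `μ` any `ℤ`-orientation in degree `2k`).
[cite: McDuffSalamon2017, Ex. 4.4.3 (v)] [cite: MilnorStasheff1974, §12 and §14] -/
theorem kroneckerPairing_chernClass_eq_sum_vectorFieldIndex {n : ℕ} [ChartedSpace (EuclideanSpace ℝ (Fin n)) M]
    (hk : 0 < finrank ℝ E / 2) (hn : 2 * (finrank ℝ E / 2) = n) {Y : Π x : M, TangentSpace I x}
    (hY : Continuous fun x ↦ (⟨x, Y x⟩ : TangentBundle I M)) (hZ : {x | Y x = 0}.Finite)
    (μ : HomologicalOrientation ℤ M n) :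
    kroneckerPairing ℤ ℤ M n (degCast ℤ hn (J.chernClass (finrank ℝ E / 2))) μ.fundamentalClass =
      ∑ p ∈ hZ.toFinset, J.vectorFieldIndex hY hk hn μ p := by
  have h := J.complexTangentBundle.kroneckerPairing_chernClassZ_fundamentalClass (J.fieldSection Y)
    (J.continuous_fieldSection hY) (J.rank_complexTangentBundle_pos hk) (J.two_mul_rank_complexTangentBundle hn)
    (J.finite_zeroSet_fieldSection hZ) μ
  rw [J.complexTangentBundle.degCast_chernClassZ_congr J.rank_complexTangentBundle
    (J.two_mul_rank_complexTangentBundle hn) hn] at h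
  have hfs : (J.finite_zeroSet_fieldSection hZ).toFinset = hZ.toFinset := by
    ext p
    rw [Finite.mem_toFinset, Finite.mem_toFinset, J.zeroSet_fieldSection Y]
  exact h.trans (Finset.sum_congr hfs fun _ _ ↦ rfl)

omit [IsManifold I 1 M] [T2Space M] [CompactSpace M] in
/-- `dim_ℝ ℝ⁴ / 2 = 2`. [folklore] -/
theorem finrank_euclideanSpace_four_div_two : finrank ℝ (EuclideanSpace ℝ (Fin 4)) / 2 = 2 := by
  rw [finrank_euclideanSpace_fin]

/-- **Dimension four: `⟨c₂(TN, J), [N]_μ⟩ = Σ_{Y p = 0} ind_p(Y)`** for a closed almost complex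
`4`-manifold, any `ℤ`-orientation `μ` and any continuous vector field `Y` with finitely many zeros —
the localised form of hypothesis `hc₂` (`⟨c₂(TN, J), [N]⟩ = χ(N)`, McDuff–Salamon Ex. 4.4.3 (v))
of `hirzebruch_firstChernClass_sq_eq_almostComplex_four_of_signatureTheorem_of_topChernNumber`,
which is thereby reduced to the Poincaré–Hopf count `Σ_p ind_p(Y) = χ(N)` for one vector field.
[cite: McDuffSalamon2017, Ex. 4.4.3 (v)] [cite: Hirzebruch1966, Thm. 4.10.1] -/
theorem kroneckerPairing_chernClass_two_eq_sum_vectorFieldIndex (N : Type) [TopologicalSpace N] [T2Space N]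
    [CompactSpace N] [ChartedSpace (EuclideanSpace ℝ (Fin 4)) N] [IsManifold (𝓡 4) ∞ N]
    (J : AlmostComplexStructure (𝓡 4) ∞ N) {Y : Π x : N, TangentSpace (𝓡 4) x}
    (hY : Continuous fun x ↦ (⟨x, Y x⟩ : TangentBundle (𝓡 4) N)) (hZ : {x | Y x = 0}.Finite)
    (μ : HomologicalOrientation ℤ N 4) :
    kroneckerPairing ℤ ℤ N 4 (degCast ℤ (by norm_num : 2 * 2 = 4) (J.chernClass 2)) μ.fundamentalClass =
      ∑ p ∈ hZ.toFinset,
        J.vectorFieldIndex hY (by rw [finrank_euclideanSpace_four_div_two]; exact two_pos)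
          (by rw [finrank_euclideanSpace_four_div_two]) μ p := by
  have h := J.kroneckerPairing_chernClass_eq_sum_vectorFieldIndex
    (by rw [finrank_euclideanSpace_four_div_two]; exact two_pos) (by rw [finrank_euclideanSpace_four_div_two]) hY hZ μ
  rw [J.degCast_chernClass_congr (i := finrank ℝ (EuclideanSpace ℝ (Fin 4)) / 2) (j := 2)
    finrank_euclideanSpace_four_div_two (by rw [finrank_euclideanSpace_four_div_two]) (by norm_num)] at h
  exact h

end AlmostComplexStructure

end Literature.Geometry.Symplectic

end
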